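import Mathlib
import Summits.ValiantsHypothesis.ValiantsHypothesis.Theorems.KPlusLogSqLawTropicalBSingleGauge

/-!
# Route «KPlusLogSqLaw», crux `TropicalB` (stmt-ValiantsHypothesis-19771) — EVERY dominant term HAS a certifying row gauge
# (Egerváry potentials in the kernel), so the DUAL-REGIME number of a chain is a finite intrinsic invariant (`≤ n + 1`)

HONEST FRAMING.  Helper file (cell `pub-symmetroid`, seat val-sym-trop-p5 g10, 2026-08-27) `--supports` the crux
`Summit.ValiantsHypothesis.ValiantsHypothesis.Theses.KPlusLogSqLaw.TropicalB` (item `stmt-ValiantsHypothesis-19771`); companion of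
`…TropicalBSingleGauge` (p554764: a chain with `G` affine row-dual regimes has `n ≤ m(G·mK − 1)`).  That law is CONDITIONAL on certifying
gauges; this file proves they always EXIST term by term, so for every dominant chain the least number `G` of affine dual regimes is a
well-defined number `≤ n + 1` and the law reads unconditionally `n < G·m²K`.  Nothing here bounds `TropicalB`; nothing bears on `TropicalB` in
its window, `WeakLifting`, DoorA26 / DoorA34, `MatrixDescartes` (stmt-ValiantsHypothesis-18050) or VP ≠ VNP.

* `exists_addPotential` — ADDITIVE MAX-PLUS POTENTIALS: integer arc weights `a` on the complete digraph on `Fin R` all of whose cycles through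
  distinct vertices have sum `≤ 0` admit integer potentials `e` with `e j + a i j ≤ e i` («no negative cycle ⇒ feasible potentials»; `e i` =
  the largest sum of a path through distinct vertices starting at `i`; additive twin of the tree's
  `PriceOfContractivity.CycleBalancing.exists_potential`).
* `sum_gain_le_zero` — along a dominant term `q` at slope `θ`, every CYCLIC EXCHANGE (rows `v 0, …, v n` distinct, row `v t` taking the column
  of row `v (t+1)` with any present class) has total gain `≤ 0` (the exchanged term is present and differs from `q`, or is `q`).
* `exists_rowGauge_of_isDominant` — **EGERVÁRY FOR A DOMINANT TERM**: there are INTEGER row potentials `u` such that in every column the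
  term's incidence maximises `θ·d l − v i j l − u i` over the present incidences — the column-wise certificate of `…TropicalBSingleGauge`.
* `exists_gauges_of_chain` — hence every dominant chain is certified by SOME family of affine gauges with `n + 1` pieces (one constant gauge per
  term): the hypothesis of `SingleGauge.chain_le_of_gaugePieces` is always satisfiable with `G = n + 1`, and the DUAL-REGIME NUMBER (least such
  `G`) is an intrinsic invariant of the chain in `[1, n + 1]`.

[folklore] J. Egerváry (1931) / LP duality for the assignment problem; Bellman–Ford feasibility of potentials.  Packaging of the cell.
-/

set_option linter.dupNamespace false
set_option autoImplicit false

namespace Summit.ValiantsHypothesis.ValiantsHypothesis.Theorems.KPlusLogSqLaw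

open Summit.ValiantsHypothesis.ValiantsHypothesis.Theorems.MatrixDescartes.Negative
open Summit.ValiantsHypothesis.ValiantsHypothesis.Theorems.LacunarySymmetroidMatrixDescartes
open Summit.ValiantsHypothesis.ValiantsHypothesis.Theorems.LacunarySymmetroidMatrixDescartes.TropicalCensus
open scoped BigOperators
open Finset

namespace SingleGauge

/-! ## 1. Additive max-plus potentials -/

/-- **Closing a path prefix into a cycle** (additive).  If every cycle through distinct vertices has sum `≤ 0` and
`q : Fin (k+1) → Fin R` is injective, then for `n ≤ k` the prefix `q 0 → ⋯ → q n` closed up by the arc `q n → q 0` is such a cycle: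
`(Σ_{t<n} a (q t) (q (t+1))) + a (q n) (q 0) ≤ 0`. [folklore] -/
theorem prefix_add_closing_nonpos {R : ℕ} (a : Fin R → Fin R → ℤ)
    (ha : ∀ (n : ℕ) (v : Fin (n + 1) → Fin R), Function.Injective v → ∑ t : Fin (n + 1), a (v t) (v (t + 1)) ≤ 0)
    {k : ℕ} (q : Fin (k + 1) → Fin R) (hq : Function.Injective q) (n : ℕ) (hn : n ≤ k) :
    (∑ t : Fin n, a (q ⟨t, by omega⟩) (q ⟨t + 1, by omega⟩)) + a (q ⟨n, by omega⟩) (q 0) ≤ 0 := by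
  have h := ha n (fun t => q ⟨t, by omega⟩) (fun x y hxy => Fin.ext (Fin.mk.inj_iff.mp (hq hxy)))
  simp only [Fin.sum_univ_castSucc, Fin.coeSucc_eq_succ, Fin.last_add_one, Fin.val_castSucc,
    Fin.val_succ, Fin.val_last, Fin.val_zero, Fin.zero_eta] at h
  exact h

/-- **Additive max-plus potentials.**  Integer arc weights `a` on the complete digraph on `Fin R` such that every cycle through distinct
vertices has `Σ a ≤ 0` admit integer potentials `e` with `e j + a i j ≤ e i` for all `i j` (`e i` = the largest sum of a path through
distinct vertices starting at `i`). [folklore: Bellman–Ford; additive form of `CycleBalancing.exists_potential`] -/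
theorem exists_addPotential {R : ℕ} (a : Fin R → Fin R → ℤ)
    (ha : ∀ (n : ℕ) (v : Fin (n + 1) → Fin R), Function.Injective v → ∑ t : Fin (n + 1), a (v t) (v (t + 1)) ≤ 0) :
    ∃ e : Fin R → ℤ, ∀ i j, e j + a i j ≤ e i := by
  -- `S i`: the sums of the paths through distinct vertices starting at `i`.
  obtain ⟨S, hS⟩ : ∃ S : Fin R → Set ℤ, ∀ i x, x ∈ S i ↔ ∃ (k : ℕ) (q : Fin (k + 1) → Fin R),
      Function.Injective q ∧ q 0 = i ∧ ∑ t : Fin k, a (q t.castSucc) (q t.succ) = x :=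
    ⟨fun i => {x | ∃ (k : ℕ) (q : Fin (k + 1) → Fin R),
      Function.Injective q ∧ q 0 = i ∧ ∑ t : Fin k, a (q t.castSucc) (q t.succ) = x}, fun _ _ => Iff.rfl⟩
  have hfin : ∀ i, (S i).Finite := by
    intro i
    refine Set.Finite.subset (Set.finite_iUnion fun k : Fin R => Set.finite_range
      (fun q : Fin (k.val + 1) → Fin R => ∑ t : Fin k.val, a (q t.castSucc) (q t.succ))) ?_
    intro x hx
    obtain ⟨k, q, hq, -, rfl⟩ := (hS i x).mp hx
    have hk : k < R := by
      have := Fintype.card_le_of_injective q hq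
      simp only [Fintype.card_fin] at this
      omega
    exact Set.mem_iUnion.mpr ⟨⟨k, hk⟩, q, rfl⟩
  have hzero : ∀ i, (0 : ℤ) ∈ S i := fun i =>
    (hS i 0).mpr ⟨0, fun _ => i, fun x y _ => Subsingleton.elim (α := Fin 1) x y, rfl, Fin.sum_univ_zero _⟩
  have hle : ∀ {k : ℕ} (q : Fin (k + 1) → Fin R), Function.Injective q →
      ∑ t : Fin k, a (q t.castSucc) (q t.succ) ≤ sSup (S (q 0)) := fun q hq =>
    le_csSup (hfin _).bddAbove ((hS _ _).mpr ⟨_, q, hq, rfl, rfl⟩)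
  refine ⟨fun i => sSup (S i), fun i j => ?_⟩
  -- an optimal path `q` from `j`
  obtain ⟨k, q, hq, hq0, hqv⟩ := (hS j _).mp (Set.Nonempty.csSup_mem ⟨0, hzero j⟩ (hfin j))
  suffices key : (∑ t : Fin k, a (q t.castSucc) (q t.succ)) + a i j ≤ sSup (S i) by
    rwa [hqv] at key
  by_cases hi : i ∈ Set.range q
  · -- `i = q n`: close the prefix into a cycle, keep the suffix as a path from `i`.
    obtain ⟨⟨n, hn⟩, hs⟩ := hi
    obtain ⟨m, rfl⟩ : ∃ m, k = n + m := Nat.exists_eq_add_of_le (by omega)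
    have hclose := prefix_add_closing_nonpos a ha q hq n (by omega)
    rw [hs, hq0] at hclose
    have hsuf := hle (fun t : Fin (m + 1) => q ⟨n + t.val, by omega⟩)
      (fun x y hxy => Fin.ext (Nat.add_left_cancel (Fin.mk.inj_iff.mp (hq hxy))))
    simp only [Fin.val_castSucc, Fin.val_succ, Fin.val_zero, Nat.add_zero, hs] at hsuf
    have hP : (∑ t : Fin n, a (q (Fin.castAdd m t).castSucc) (q (Fin.castAdd m t).succ)) =
        ∑ t : Fin n, a (q ⟨t, by omega⟩) (q ⟨t + 1, by omega⟩) :=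
      Finset.sum_congr rfl fun t _ => rfl
    have hQ : (∑ t : Fin m, a (q (Fin.natAdd n t).castSucc) (q (Fin.natAdd n t).succ)) =
        ∑ t : Fin m, a (q ⟨n + t.val, by omega⟩) (q ⟨n + (t.val + 1), by omega⟩) :=
      Finset.sum_congr rfl fun t _ => rfl
    rw [Fin.sum_univ_add, hP, hQ]
    linarith
  · -- `i ∉ range q`: prepend `i`.
    have hq' : Function.Injective (Fin.cons i q : Fin (k + 1 + 1) → Fin R) :=
      Fin.cons_injective_iff.mpr ⟨hi, hq⟩
    have h := hle (Fin.cons i q : Fin (k + 1 + 1) → Fin R) hq'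
    rw [Fin.sum_univ_succ] at h
    simp only [Fin.castSucc_zero, Fin.cons_zero, Fin.cons_succ, Fin.castSucc_succ, hq0] at h
    linarith

/-! ## 2. Cyclic exchanges along a dominant term -/

variable {m K : ℕ}

/-- **Cyclic exchange gain.**  Let `q = (σ, μ)` be dominant at `θ`, `w : Fin (n+1) → Fin m` distinct rows, and for each `t` a class
`l t` present at the entry (row `w t`, column `c t`) where `c t = σ⁻¹ (w (t+1))` is the column of the NEXT row.  Then the total gain of
letting every row `w t` take over column `c t` with class `l t`,
`Σ_t [(θ·d (l t) − v (w t) (c t) (l t)) − (θ·d (μ (c t)) − v (w (t+1)) (c t) (μ (c t)))] ≤ 0`: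
the exchanged term is present, and it is either `q` itself (gain `0`) or loses to `q`. [folklore] -/
theorem sum_gain_le_zero (d : Fin K → ℕ) (v ε : Fin m → Fin m → Fin K → ℤ) (θ : ℤ)
    (q : Equiv.Perm (Fin m) × (Fin m → Fin K)) (hq : IsDominant d v ε θ q) {n : ℕ}
    (w : Fin (n + 1) → Fin m) (hw : Function.Injective w) (l : Fin (n + 1) → Fin K)
    (hl : ∀ t, ε (w t) (q.1.symm (w (t + 1))) (l t) ≠ 0) :
    ∑ t : Fin (n + 1), ((θ * (d (l t) : ℤ) - v (w t) (q.1.symm (w (t + 1))) (l t)) -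
      (θ * (d (q.2 (q.1.symm (w (t + 1)))) : ℤ) - v (w (t + 1)) (q.1.symm (w (t + 1))) (q.2 (q.1.symm (w (t + 1)))))) ≤ 0 := by
  classical
  -- the columns taken over
  set c : Fin (n + 1) → Fin m := fun t => q.1.symm (w (t + 1)) with hc
  have hcinj : Function.Injective c := by
    intro t t' h
    have : w (t + 1) = w (t' + 1) := q.1.symm.injective h
    exact add_right_cancel (hw this)
  have hqc : ∀ t, q.1 (c t) = w (t + 1) := fun t => by simp [hc]
  -- the exchanged assignment as a function on columns
  let σ' : Fin m → Fin m := fun j => if h : ∃ t, c t = j then w (Classical.choose h) else q.1 j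
  let μ' : Fin m → Fin K := fun j => if h : ∃ t, c t = j then l (Classical.choose h) else q.2 j
  have hσ'c : ∀ t, σ' (c t) = w t := by
    intro t
    have h : ∃ t', c t' = c t := ⟨t, rfl⟩
    simp only [σ', dif_pos h]
    exact congrArg w (hcinj (Classical.choose_spec h))
  have hμ'c : ∀ t, μ' (c t) = l t := by
    intro t
    have h : ∃ t', c t' = c t := ⟨t, rfl⟩
    simp only [μ', dif_pos h]
    exact congrArg l (hcinj (Classical.choose_spec h))
  have hσ'off : ∀ j, (¬ ∃ t, c t = j) → σ' j = q.1 j := fun j h => by simp only [σ', dif_neg h]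
  have hμ'off : ∀ j, (¬ ∃ t, c t = j) → μ' j = q.2 j := fun j h => by simp only [μ', dif_neg h]
  -- σ' is injective, hence a permutation
  have hinj : Function.Injective σ' := by
    intro j j' hjj'
    by_cases hj : ∃ t, c t = j <;> by_cases hj' : ∃ t, c t = j'
    · obtain ⟨t, rfl⟩ := hj
      obtain ⟨t', rfl⟩ := hj'
      rw [hσ'c, hσ'c] at hjj'
      rw [hw hjj']
    · obtain ⟨t, rfl⟩ := hj
      rw [hσ'c, hσ'off j' hj'] at hjj'
      -- w t = q.1 j' ⇒ j' = σ⁻¹ (w t) = c (t - 1)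
      exfalso
      refine hj' ⟨t - 1, ?_⟩
      show q.1.symm (w (t - 1 + 1)) = j'
      rw [sub_add_cancel, hjj', Equiv.symm_apply_apply]
    · obtain ⟨t', rfl⟩ := hj'
      rw [hσ'c, hσ'off j hj] at hjj'
      exfalso
      refine hj ⟨t' - 1, ?_⟩
      show q.1.symm (w (t' - 1 + 1)) = j
      rw [sub_add_cancel, ← hjj', Equiv.symm_apply_apply]
    · rw [hσ'off j hj, hσ'off j' hj'] at hjj'
      exact q.1.injective hjj'
  let σE : Equiv.Perm (Fin m) := Equiv.ofBijective σ' (Finite.injective_iff_bijective.mp hinj)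
  have hσE : ∀ j, σE j = σ' j := fun j => rfl
  -- the exchanged term is present
  have hpres : termSign ε (σE, μ') ≠ 0 := by
    unfold termSign
    refine mul_ne_zero (Units.ne_zero _) ?_
    rw [Finset.prod_ne_zero_iff]
    intro j _
    show ε (σ' j) j (μ' j) ≠ 0
    by_cases hj : ∃ t, c t = j
    · obtain ⟨t, rfl⟩ := hj
      rw [hσ'c, hμ'c]
      exact hl t
    · rw [hσ'off j hj, hμ'off j hj]
      exact present_of_termSign_ne_zero ε q hq.1 j
  -- its weight is the weight of q plus the total gain
  have hdiff : tropWeight d v θ (σE, μ') - tropWeight d v θ q =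
      ∑ t : Fin (n + 1), ((θ * (d (l t) : ℤ) - v (w t) (c t) (l t)) -
        (θ * (d (q.2 (c t)) : ℤ) - v (w (t + 1)) (c t) (q.2 (c t)))) := by
    rw [tropWeight_eq_sum, tropWeight_eq_sum, ← Finset.sum_sub_distrib]
    -- the summand vanishes off the image of c
    have hzero : ∀ j ∈ (univ : Finset (Fin m)), j ∉ univ.image c →
        ((θ * (d (μ' j) : ℤ) - v (σE j) j (μ' j)) - (θ * (d (q.2 j) : ℤ) - v (q.1 j) j (q.2 j))) = 0 := by
      intro j _ hj
      have hj' : ¬ ∃ t, c t = j := fun ⟨t, ht⟩ => hj (mem_image.mpr ⟨t, mem_univ _, ht⟩)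
      rw [hσE, hσ'off j hj', hμ'off j hj', sub_self]
    rw [← Finset.sum_subset (subset_univ (univ.image c)) hzero, Finset.sum_image fun t _ t' _ h => hcinj h]
    refine Finset.sum_congr rfl fun t _ => ?_
    rw [hσE, hσ'c, hμ'c, hqc]
  -- dominance: the exchanged term is q (gain 0) or strictly worse
  have hle : tropWeight d v θ (σE, μ') ≤ tropWeight d v θ q := by
    by_cases heq : (σE, μ') = q
    · rw [heq]
    · exact le_of_lt (hq.2 _ heq hpres)
  have : ∑ t : Fin (n + 1), ((θ * (d (l t) : ℤ) - v (w t) (c t) (l t)) -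
        (θ * (d (q.2 (c t)) : ℤ) - v (w (t + 1)) (c t) (q.2 (c t)))) ≤ 0 := by
    rw [← hdiff]; linarith
  simpa only [hc] using this

/-! ## 3. Egerváry: every dominant term has a certifying row gauge -/

/-- **EGERVÁRY FOR A DOMINANT TERM.**  If `q = (σ, μ)` is the unique optimum of the design `(d, v, ε)` at the integer slope `θ`, there are
INTEGER row potentials `u` such that in every column `j` the incidence of `q` maximises the gauged score `θ·d l − v i j l − u i` over all
present incidences `(i, l)` of that column — the column-wise certificate of `…TropicalBSingleGauge` (one constant gauge `α = 0, β = u`).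
Proof: potentials for the row digraph weighted by the best take-over gains (`exists_addPotential`), whose cycles are non-positive by
`sum_gain_le_zero`. [folklore: Egerváry 1931 / LP duality for the assignment problem] -/
theorem exists_rowGauge_of_isDominant (d : Fin K → ℕ) (v ε : Fin m → Fin m → Fin K → ℤ) (θ : ℤ)
    (q : Equiv.Perm (Fin m) × (Fin m → Fin K)) (hq : IsDominant d v ε θ q) :
    ∃ u : Fin m → ℤ, ∀ (j i : Fin m) (l : Fin K), ε i j l ≠ 0 →
      (θ * (d l : ℤ) - v i j l) - u i ≤ (θ * (d (q.2 j) : ℤ) - v (q.1 j) j (q.2 j)) - u (q.1 j) := by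
  classical
  -- scores, a uniform bound, and the arc weights of the row digraph
  let sc : Fin m → Fin m → Fin K → ℤ := fun i j l => θ * (d l : ℤ) - v i j l
  let M : ℤ := ∑ i, ∑ j, ∑ l, |sc i j l| + 1
  have hM : ∀ i j l, |sc i j l| < M := by
    intro i j l
    have h1 : |sc i j l| ≤ ∑ l', |sc i j l'| := Finset.single_le_sum (fun l' _ => abs_nonneg (sc i j l')) (mem_univ l)
    have h2 : ∑ l', |sc i j l'| ≤ ∑ j', ∑ l', |sc i j' l'| :=
      Finset.single_le_sum (fun j' _ => Finset.sum_nonneg fun l' _ => abs_nonneg (sc i j' l')) (mem_univ j)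
    have h3 : ∑ j', ∑ l', |sc i j' l'| ≤ ∑ i', ∑ j', ∑ l', |sc i' j' l'| :=
      Finset.single_le_sum (fun i' _ => Finset.sum_nonneg fun j' _ => Finset.sum_nonneg fun l' _ => abs_nonneg (sc i' j' l'))
        (mem_univ i)
    show |sc i j l| < ∑ i, ∑ j, ∑ l, |sc i j l| + 1
    linarith
  let B : ℤ := 2 * M * ((m : ℤ) + 1)
  let P : Fin m → Fin m → Finset (Fin K) := fun i i' => univ.filter (fun l => ε i (q.1.symm i') l ≠ 0)
  let a : Fin m → Fin m → ℤ := fun i i' =>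
    if h : (P i i').Nonempty then (P i i').sup' h (fun l => sc i (q.1.symm i') l) - sc i' (q.1.symm i') (q.2 (q.1.symm i'))
    else -B
  -- every arc weight is at most 2M
  have ha_le : ∀ i i', a i i' ≤ 2 * M := by
    intro i i'
    by_cases h : (P i i').Nonempty
    · simp only [a, dif_pos h]
      obtain ⟨l₀, hl₀, hsup⟩ := Finset.exists_mem_eq_sup' h (fun l => sc i (q.1.symm i') l)
      rw [hsup]
      have := hM i (q.1.symm i') l₀
      have := hM i' (q.1.symm i') (q.2 (q.1.symm i'))
      have e1 := abs_lt.mp ‹|sc i (q.1.symm i') l₀| < M›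
      have e2 := abs_lt.mp ‹|sc i' (q.1.symm i') (q.2 (q.1.symm i'))| < M›
      linarith [e1.1, e1.2, e2.1, e2.2]
    · simp only [a, dif_neg h]
      have hM0 : 0 < M := lt_of_le_of_lt (abs_nonneg _) (hM (q.1 ⟨0, ?_⟩) ⟨0, ?_⟩ (q.2 ⟨0, ?_⟩)) <;> try exact Fin.pos i
      show -(2 * M * ((m : ℤ) + 1)) ≤ 2 * M
      nlinarith
  -- cycles of the row digraph are non-positive
  have hcyc : ∀ (n : ℕ) (w : Fin (n + 1) → Fin m), Function.Injective w → ∑ t : Fin (n + 1), a (w t) (w (t + 1)) ≤ 0 := by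
    intro n w hw
    have hn : n + 1 ≤ m := by
      have := Fintype.card_le_of_injective w hw
      simpa only [Fintype.card_fin] using this
    by_cases hall : ∀ t, (P (w t) (w (t + 1))).Nonempty
    · -- all take-overs possible: choose best classes and exchange
      have hch : ∀ t, ∃ l₀ ∈ P (w t) (w (t + 1)),
          (P (w t) (w (t + 1))).sup' (hall t) (fun l => sc (w t) (q.1.symm (w (t + 1))) l) =
            sc (w t) (q.1.symm (w (t + 1))) l₀ := fun t => Finset.exists_mem_eq_sup' (hall t) _
      choose l hlP hlsup using hch
      have hlpres : ∀ t, ε (w t) (q.1.symm (w (t + 1))) (l t) ≠ 0 := fun t => by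
        have := hlP t
        simp only [P, mem_filter, mem_univ, true_and] at this
        exact this
      have hg := sum_gain_le_zero d v ε θ q hq w hw l hlpres
      refine le_of_eq_of_le (Finset.sum_congr rfl fun t _ => ?_) hg
      simp only [a, dif_pos (hall t), hlsup]
      rfl
    · -- some take-over impossible: that arc weighs −B
      push Not at hall
      obtain ⟨t₀, ht₀e⟩ := hall
      have ht₀ : ¬ (P (w t₀) (w (t₀ + 1))).Nonempty := Finset.not_nonempty_iff_eq_empty.mpr ht₀e
      have hsplit := Finset.add_sum_erase (univ : Finset (Fin (n + 1))) (fun t => a (w t) (w (t + 1))) (mem_univ t₀)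
      have hrest : ∑ t ∈ univ.erase t₀, a (w t) (w (t + 1)) ≤ (univ.erase t₀).card • (2 * M) :=
        Finset.sum_le_card_nsmul _ _ _ fun t _ => ha_le _ _
      rw [Finset.card_erase_of_mem (mem_univ _), card_univ, Fintype.card_fin, nsmul_eq_mul] at hrest
      have h0 : a (w t₀) (w (t₀ + 1)) = -B := by simp only [a, dif_neg ht₀]
      rw [← hsplit, h0]
      have hM0 : 0 ≤ M := le_of_lt (lt_of_le_of_lt (abs_nonneg _) (hM (w t₀) (w t₀) (q.2 (w t₀))))
      have : ((n + 1 - 1 : ℕ) : ℤ) * (2 * M) ≤ (m : ℤ) * (2 * M) := by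
        have : ((n + 1 - 1 : ℕ) : ℤ) ≤ (m : ℤ) := by exact_mod_cast (by omega : n + 1 - 1 ≤ m)
        nlinarith
      show -(2 * M * ((m : ℤ) + 1)) + ∑ t ∈ univ.erase t₀, a (w t) (w (t + 1)) ≤ 0
      nlinarith
  obtain ⟨e, he⟩ := exists_addPotential a hcyc
  refine ⟨e, fun j i l hil => ?_⟩
  -- the arc i → σ j bounds the single take-over (i, j, l)
  set i' := q.1 j with hi'
  have hj : q.1.symm i' = j := by rw [hi', Equiv.symm_apply_apply]
  have hP : l ∈ P i i' := by
    simp only [P, mem_filter, mem_univ, true_and, hj]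
    exact hil
  have hne : (P i i').Nonempty := ⟨l, hP⟩
  have h1 : sc i j l - sc i' j (q.2 j) ≤ a i i' := by
    simp only [a, dif_pos hne, hj]
    exact sub_le_sub_right (Finset.le_sup' (fun l => sc i j l) hP) _
  have h2 := he i i'
  show (θ * (d l : ℤ) - v i j l) - e i ≤ (θ * (d (q.2 j) : ℤ) - v i' j (q.2 j)) - e i'
  have : sc i j l - sc i' j (q.2 j) ≤ e i - e i' := h1.trans (by linarith)
  simp only [sc] at this
  linarith

/-- **Every dominant chain admits certifying gauges** (one constant gauge per term): the hypothesis of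
`SingleGauge.chain_le_of_gaugePieces` holds with `G = n + 1` pieces and the identity label.  Hence the least number of affine row-dual
regimes of a dominant chain is a well-defined number in `[1, n + 1]`, and the single-gauge law `n ≤ m(G·mK − 1)` applies to EVERY chain with
its own `G`. [folklore LP duality; packaging of the cell] -/
theorem exists_gauges_of_chain (d : Fin K → ℕ) (v ε : Fin m → Fin m → Fin K → ℤ) {n : ℕ}
    (θ : Fin (n + 1) → ℤ) (p : Fin (n + 1) → Equiv.Perm (Fin m) × (Fin m → Fin K)) (hdom : ∀ k, IsDominant d v ε (θ k) (p k)) :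
    ∃ α β : Fin (n + 1) → Fin m → ℚ, ∀ (k : Fin (n + 1)) (j i : Fin m) (l : Fin K), ε i j l ≠ 0 →
      ((θ k : ℚ) * (d l : ℚ) - (v i j l : ℚ)) - (α k i * (θ k : ℚ) + β k i) ≤
        ((θ k : ℚ) * (d ((p k).2 j) : ℚ) - (v ((p k).1 j) j ((p k).2 j) : ℚ)) - (α k ((p k).1 j) * (θ k : ℚ) + β k ((p k).1 j)) := by
  have hex : ∀ k, ∃ u : Fin m → ℤ, ∀ (j i : Fin m) (l : Fin K), ε i j l ≠ 0 →
      (θ k * (d l : ℤ) - v i j l) - u i ≤ (θ k * (d ((p k).2 j) : ℤ) - v ((p k).1 j) j ((p k).2 j)) - u ((p k).1 j) :=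
    fun k => exists_rowGauge_of_isDominant d v ε (θ k) (p k) (hdom k)
  choose u hu using hex
  refine ⟨fun _ _ => 0, fun k i => (u k i : ℚ), fun k j i l hil => ?_⟩
  have h := hu k j i l hil
  have h' : (((θ k * (d l : ℤ) - v i j l) - u k i : ℤ) : ℚ) ≤ (((θ k * (d ((p k).2 j) : ℤ) - v ((p k).1 j) j ((p k).2 j)) - u k ((p k).1 j) : ℤ) : ℚ) := by
    exact_mod_cast h
  push_cast at h'
  linarith

/-- **The dual-regime reading, unconditional form.**  Every dominant chain with distinct consecutive terms satisfies the single-gauge law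
with SOME number of regimes `G ≤ n + 1`; in particular (the trivial end of the scale, recorded for completeness) `n ≤ m·((n+1)·(m·K) − 1)`
holds for every such chain with `m·K ≥ 1`. [packaging of the cell] -/
theorem chain_le_of_allGauges (d : Fin K → ℕ) (v ε : Fin m → Fin m → Fin K → ℤ) {n : ℕ}
    (θ : Fin (n + 1) → ℤ) (hθ : StrictMono θ) (p : Fin (n + 1) → Equiv.Perm (Fin m) × (Fin m → Fin K))
    (hdom : ∀ k, IsDominant d v ε (θ k) (p k)) (hne : ∀ k : Fin n, p k.castSucc ≠ p k.succ) :
    n ≤ m * ((n + 1) * (m * K) - 1) := by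
  obtain ⟨α, β, h⟩ := exists_gauges_of_chain d v ε θ p hdom
  exact chain_le_of_gaugePieces d v ε α β θ hθ p hdom hne id monotone_id h

end SingleGauge

end Summit.ValiantsHypothesis.ValiantsHypothesis.Theorems.KPlusLogSqLaw
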